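import Mathlib.Algebra.Homology.DerivedCategory.Ext.ExactSequences
import Mathlib.Algebra.Homology.ShortComplex.Ab
import Mathlib.CategoryTheory.Sites.SheafCohomology.Basic
import Mathlib.GroupTheory.SpecificGroups.Cyclic
import Mathlib.GroupTheory.Perm.Cycle.Type
import Literature.AlgebraicGeometry.Motives.EllAdicComparison
import HarnessLib

/-!
# Finiteness of `Hⁱ(Y_ét, M)` for proper `Y`: the reduction to `ℤ/ℓ`-coefficients (Milne VI §2)

`Literature.AlgebraicGeometry.Motives.finite_etaleCohomology_of_isProper`
(`EllAdicComparison.lean`) is the named fact **Milne VI Cor. 2.8 / Thm. 2.1** in the separably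
closed, constant-coefficient case: for `K` separably closed, `Y → Spec K` proper and `M` a finite
abelian group, Mathlib's `Hⁱ(Y_ét, M) = Sheaf.H (constantSheaf _ _ M) i` is finite.

Its printed proof (Milne VI §2, proof of Thm. 2.1, sketched after Artin, *Théorèmes de
représentabilité pour les espaces algébriques* VII and SGA 4 XII–XIV) is the proper base change /
finiteness theory and is far outside Mathlib, which computes no étale cohomology group of a
non-empty scheme (no Kummer or Artin–Schreier sequence on `Y_ét`, no `Pic = H¹(𝔾ₘ)`, no Tsen, no
cohomology of curves, no `Rⁱπ_*`, no Leray spectral sequence, no Stein factorisation, no theorem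
on formal functions, no Grothendieck existence, no Artin approximation). This file lands the one
step of that proof which *is* formal — the dévissage in the coefficients, Milne's "method of
Step 3" as used in Steps 5 and 6 ("With the method of Step 3, one reduces this to the case
`F = ℤ/(l)`"; "Again it is only necessary to consider the case that `F = ℤ/(l)`"):

* `finite_sheafH_constantSheaf_of_prime` — **proved**, for any site `(C, J)` with abelian sheaf
  cohomology: if `Hⁿ(constantSheaf ℤ/ℓ)` is finite for every prime `ℓ`, then `Hⁿ(constantSheaf M)`
  is finite for every finite abelian group `M` (induction on `|M|`: Cauchy gives `x ∈ M` of prime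
  order `ℓ`, the constant-sheaf functor is exact, and `Hⁿ` is exact in the middle on short exact
  sequences, Mathlib `Ext.covariant_sequence_exact₂'`);
* `finite_etaleCohomology_of_isProper_of_zmod` — **proved**: the case `M = ℤ/ℓ`, `ℓ` prime, of
  `finite_etaleCohomology_of_isProper` — `Hⁱ(Y_ét, ℤ/ℓ)` finite for `Y` proper over a separably
  closed field, every prime `ℓ`, every `i ≥ 0`, taken as an EXPLICIT HYPOTHESIS — implies
  `finite_etaleCohomology_of_isProper`; with the trivial converse,
  `finite_etaleCohomology_of_isProper_iff_zmod`.

The `ℤ/ℓ` case is **not** a named fact of the tree (D-0026). It was briefly the named fact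
`finite_etaleCohomology_zmod_of_isProper` (p17800), merged back into the hypothesis of
`finite_etaleCohomology_of_isProper_of_zmod` under the split review of 2026-08-15: a special case
proved equivalent to its parent is not a decomposition child — read over `X = Spec k_s` it still
carries the whole printed proof of Thm. 2.1 (Lemma 2.9 and Steps 4–6: proper base change for
relative curves via `π₁` and `Pic`, Grothendieck's existence theorem, Artin approximation,
Artin–Schreier for `l = char k`, reduction to relative dimension `≤ 1`, Artin VII / SGA 4
XII–XIV), where "one reduces this to the case `F = ℤ/(l)`" is a step inside that induction, not a
separately stated theorem. What remains named is the parent `finite_etaleCohomology_of_isProper`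
(VI Cor. 2.8 itself); its residual positive-degree `ℤ/ℓ` form and the proved degree `0` are in
`EllAdicComparisonZModProofs.lean`.

## References

* J. S. Milne, *Étale cohomology*, Princeton (reissue 2025): VI §2, Thm. 2.1, Cor. 2.8 and the
  proof of Thm. 2.1, Lemma 2.9 and Steps 1–6 (book pp. 222–226; held copy pp. 236–240); V 1.7 (e),
  1.8 (constructibility of the sheaf of a finite étale group scheme). [Milne2025]

## Design notes

* The general dévissage is stated for an arbitrary site with `[HasSheafify J Ab]` and `[HasExt]`,
  in the universes of `Sheaf.H`; the étale statements instantiate it at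
  `Scheme.smallEtaleTopology` (instances from `Mathlib.AlgebraicGeometry.Sites.AffineEtale`).
* Exactness of `constantSheaf J D = Functor.const _ ⋙ presheafToSheaf J D`: `Functor.const`
  preserves all (co)limits, `presheafToSheaf` is a left adjoint and is left exact under
  `HasSheafify`; recorded as theorems (`preservesFiniteLimits_constantSheaf`,
  `preservesFiniteColimits_constantSheaf`), not instances.
* Nothing here weakens `finite_etaleCohomology_of_isProper`: the `ℤ/ℓ` hypothesis of the
  reduction is a special case of it, and the two are proved equivalent
  (`finite_etaleCohomology_of_isProper_iff_zmod`). No named fact is introduced.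
-/

universe w' w v' u' u

open CategoryTheory CategoryTheory.Limits CategoryTheory.Abelian AlgebraicGeometry

noncomputable section

namespace Literature.AlgebraicGeometry.Motives

/-! ### Dévissage for sheaf cohomology with finite constant coefficients (any site) -/

section Devissage

variable {C : Type u'} [Category.{v'} C] (J : GrothendieckTopology C)

/-- The constant-sheaf functor `D ⥤ Sheaf J D` is left exact when sheafification is
(`constantSheaf J D = Functor.const Cᵒᵖ ⋙ presheafToSheaf J D`, and `Functor.const` preserves all
limits). [folklore] -/
theorem preservesFiniteLimits_constantSheaf (D : Type w) [Category.{w'} D] [HasSheafify J D] :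
    PreservesFiniteLimits (constantSheaf J D) :=
  comp_preservesFiniteLimits (Functor.const Cᵒᵖ) (presheafToSheaf J D)

/-- The constant-sheaf functor `D ⥤ Sheaf J D` is right exact (indeed preserves all colimits:
`Functor.const` does, and `presheafToSheaf` is a left adjoint). [folklore] -/
theorem preservesFiniteColimits_constantSheaf (D : Type w) [Category.{w'} D]
    [HasWeakSheafify J D] : PreservesFiniteColimits (constantSheaf J D) :=
  comp_preservesFiniteColimits (Functor.const Cᵒᵖ) (presheafToSheaf J D)

variable [HasSheafify J AddCommGrpCat.{w}] [HasExt.{w'} (Sheaf J AddCommGrpCat.{w})]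

/-- `Hⁿ` is exact in the middle: for a short exact sequence `0 → F₁ → F₂ → F₃ → 0` of abelian
sheaves, `Hⁿ(F₁) → Hⁿ(F₂) → Hⁿ(F₃)` is exact (long exact `Ext`-sequence in the second variable),
so `Hⁿ(F₂)` is finite when `Hⁿ(F₁)` and `Hⁿ(F₃)` are. [folklore] -/
theorem finite_sheafH_of_shortExact {S : ShortComplex (Sheaf J AddCommGrpCat.{w})}
    (hS : S.ShortExact) (n : ℕ) [h₁ : Finite (S.X₁.H n)] [h₃ : Finite (S.X₃.H n)] :
    Finite (S.X₂.H n) :=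
  @ShortComplex.Exact.ab_finite _
    (Ext.covariant_sequence_exact₂'
      ((constantSheaf J AddCommGrpCat.{w}).obj (AddCommGrpCat.of (ULift ℤ))) hS n) h₁ h₃

/-- Sheaf cohomology of isomorphic sheaves: finiteness transfers (`H.map` along the isomorphism
is a bijection). [folklore] -/
theorem finite_sheafH_of_iso {F G : Sheaf J AddCommGrpCat.{w}} (e : F ≅ G) (n : ℕ)
    [Finite (F.H n)] : Finite (G.H n) := by
  refine Finite.of_injective (Sheaf.H.map e.inv n) fun x y hxy => ?_
  have := congrArg (Sheaf.H.map e.hom n) hxy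
  rwa [← Sheaf.H.map_comp_apply, ← Sheaf.H.map_comp_apply, e.inv_hom_id,
    Sheaf.H.map_id_apply, Sheaf.H.map_id_apply] at this

/-- The cohomology of a zero sheaf is trivial, in particular finite. [folklore] -/
theorem finite_sheafH_of_isZero {F : Sheaf J AddCommGrpCat.{w}} (hF : IsZero F) (n : ℕ) :
    Finite (F.H n) := by
  haveI := Sheaf.subsingleton_H_of_isZero hF n
  infer_instance

/-- **Dévissage in the coefficients** (Milne VI §2, proof of Thm. 2.1, "method of Step 3" as used
in Steps 5–6: "one reduces this to the case `F = ℤ/(l)`"), sharp form. On any site, if the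
cohomology in degree `n` of the constant sheaf `ℤ/ℓ` is finite for every prime `ℓ` dividing the
order of the finite abelian group `M`, then the cohomology in degree `n` of the constant sheaf on
`M` is finite. Proof: induction on `|M|`; if `M ≠ 0`, Cauchy's theorem gives `x ∈ M` of prime
order `ℓ ∣ |M|`, the constant-sheaf functor takes `0 → ⟨x⟩ ≅ ℤ/ℓ → M → M/⟨x⟩ → 0` to a short
exact sequence of sheaves, `Hⁿ` is exact in the middle, and `|M/⟨x⟩|` divides `|M|`.
[cite: Milne2025, VI Thm. 2.1 (proof, Steps 3, 5, 6)] -/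
theorem finite_sheafH_constantSheaf_of_prime_dvd (n : ℕ) (M : AddCommGrpCat.{w}) [Finite M]
    (hℓ : ∀ (ℓ : ℕ) [Fact ℓ.Prime], ℓ ∣ Nat.card M →
      Finite (((constantSheaf J AddCommGrpCat.{w}).obj
        (AddCommGrpCat.of (ULift.{w} (ZMod ℓ)))).H n)) :
    Finite (((constantSheaf J AddCommGrpCat.{w}).obj M).H n) := by
  suffices ∀ (k : ℕ) (M : AddCommGrpCat.{w}) [Finite M], Nat.card M = k →
      (∀ (ℓ : ℕ) [Fact ℓ.Prime], ℓ ∣ Nat.card M →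
        Finite (((constantSheaf J AddCommGrpCat.{w}).obj
          (AddCommGrpCat.of (ULift.{w} (ZMod ℓ)))).H n)) →
      Finite (((constantSheaf J AddCommGrpCat.{w}).obj M).H n) from this _ M rfl hℓ
  intro k
  induction k using Nat.strong_induction_on with
  | _ k ih =>
    intro M _ hk hℓ
    by_cases hM : Subsingleton M
    · exact finite_sheafH_of_isZero J
        (Functor.map_isZero _ (AddCommGrpCat.isZero_of_subsingleton M)) n
    · rw [not_subsingleton_iff_nontrivial] at hM
      have h1 : 1 < Nat.card M := Finite.one_lt_card
      -- an element of prime order `ℓ ∣ |M|` (Cauchy)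
      haveI hprime : Fact (Nat.card M).minFac.Prime := ⟨Nat.minFac_prime h1.ne'⟩
      obtain ⟨x, hx⟩ :=
        exists_prime_addOrderOf_dvd_card' (G := M) (Nat.card M).minFac (Nat.minFac_dvd _)
      set ℓ := (Nat.card M).minFac with hℓdef
      let H : AddSubgroup M := AddSubgroup.zmultiples x
      have hH : Nat.card H = ℓ := (Nat.card_zmultiples x).trans hx
      have hlt : Nat.card (M ⧸ H) < k := by
        rw [← hk, AddSubgroup.card_eq_card_quotient_mul_card_addSubgroup H, hH]
        exact lt_mul_of_one_lt_right Nat.card_pos hprime.out.one_lt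
      -- the short exact sequence `0 → ⟨x⟩ → M → M/⟨x⟩ → 0` in `Ab`
      let S : ShortComplex AddCommGrpCat.{w} :=
        { X₁ := AddCommGrpCat.of H
          X₂ := M
          X₃ := AddCommGrpCat.of (M ⧸ H)
          f := AddCommGrpCat.ofHom H.subtype
          g := AddCommGrpCat.ofHom (QuotientAddGroup.mk' H)
          zero := by
            ext ⟨y, hy⟩
            simp }
      have hS : S.ShortExact := by
        refine ShortComplex.ShortExact.mk' ?_ ?_ ?_
        · rw [ShortComplex.ab_exact_iff]
          intro y hy
          have hy' : y ∈ H := by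
            rwa [← QuotientAddGroup.ker_mk' H, AddMonoidHom.mem_ker]
          exact ⟨⟨y, hy'⟩, rfl⟩
        · rw [AddCommGrpCat.mono_iff_injective]
          exact H.subtype_injective
        · rw [AddCommGrpCat.epi_iff_surjective]
          exact QuotientAddGroup.mk'_surjective H
      haveI := preservesFiniteLimits_constantSheaf J AddCommGrpCat.{w}
      haveI := preservesFiniteColimits_constantSheaf J AddCommGrpCat.{w}
      have hS' : (S.map (constantSheaf J AddCommGrpCat.{w})).ShortExact :=
        hS.map_of_exact (constantSheaf J AddCommGrpCat.{w})
      -- the two ends are finite: `⟨x⟩ ≅ ℤ/ℓ` by hypothesis, `M/⟨x⟩` by induction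
      haveI : Finite ((S.map (constantSheaf J AddCommGrpCat.{w})).X₃.H n) :=
        ih _ hlt (AddCommGrpCat.of (M ⧸ H)) rfl fun ℓ' _ hℓ' =>
          hℓ ℓ' (hℓ'.trans (AddSubgroup.card_quotient_dvd_card H))
      haveI : Finite ((S.map (constantSheaf J AddCommGrpCat.{w})).X₁.H n) := by
        have e : ZMod ℓ ≃+ H :=
          (ZMod.ringEquivCongr hH).symm.toAddEquiv.trans (zmodAddCyclicAddEquiv inferInstance)
        have e' : AddCommGrpCat.of (ULift.{w} (ZMod ℓ)) ≅ AddCommGrpCat.of H :=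
          AddEquiv.toAddCommGrpIso (X := AddCommGrpCat.of (ULift.{w} (ZMod ℓ)))
            (Y := AddCommGrpCat.of H) (AddEquiv.ulift.trans e)
        haveI := hℓ ℓ (Nat.minFac_dvd _)
        exact finite_sheafH_of_iso J ((constantSheaf J AddCommGrpCat.{w}).mapIso e') n
      exact finite_sheafH_of_shortExact J hS' n

/-- **Dévissage in the coefficients**, all-primes form: if `Hⁿ` of the constant sheaf `ℤ/ℓ` is
finite for every prime `ℓ`, then `Hⁿ` of the constant sheaf on every finite abelian group is
finite. [cite: Milne2025, VI Thm. 2.1 (proof, Steps 3, 5, 6)] -/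
theorem finite_sheafH_constantSheaf_of_prime (n : ℕ)
    (hℓ : ∀ (ℓ : ℕ) [Fact ℓ.Prime], Finite (((constantSheaf J AddCommGrpCat.{w}).obj
      (AddCommGrpCat.of (ULift.{w} (ZMod ℓ)))).H n))
    (M : AddCommGrpCat.{w}) [Finite M] :
    Finite (((constantSheaf J AddCommGrpCat.{w}).obj M).H n) :=
  finite_sheafH_constantSheaf_of_prime_dvd J n M fun ℓ _ _ => hℓ ℓ

end Devissage

/-! ### The reduction of Milne VI Cor. 2.8 (constant coefficients) to the case `F = ℤ/(l)` -/

/-- **Reduction of Milne VI Cor. 2.8 (separably closed base, finite constant coefficients) to the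
case `F = ℤ/(l)`.** Hypothesis `h` — stated explicitly, not a named fact of the tree (D-0026) — is
the case `M = ℤ/ℓ`, `ℓ` prime, of `finite_etaleCohomology_of_isProper`: for `K` separably closed,
`Y → Spec K` proper, `ℓ` a prime and every `i ≥ 0`, the étale cohomology group `Hⁱ(Y_ét, ℤ/ℓ)`
(Mathlib's `Sheaf.H` of the constant sheaf `ℤ/ℓ` on the small étale site `Y.Etale`,
`Scheme.smallEtaleTopology`) is finite — VI Cor. 2.8 for `k = k_s` and `F = ℤ/(l)` (constructible,
V 1.7 (e)), the case to which the printed proof of Thm. 2.1 reduces (Steps 5 and 6: "With the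
method of Step 3, one reduces this to the case `F = ℤ/(l)`"; "Again it is only necessary to
consider the case that `F = ℤ/(l)`"; no restriction `ℓ ≠ char K`: for `l = char k` Step 5 uses
`H²(Y₀, ℤ/(l)) = 0` and Step 6 the Artin–Schreier description of `R¹π_*ℤ/(l)`). Conclusion:
`finite_etaleCohomology_of_isProper` for every finite `M`, by the dévissage
`finite_sheafH_constantSheaf_of_prime` on the small étale site of `Y` (Milne VI §2, proof of
Thm. 2.1, Steps 3, 5, 6). [cite: Milne2025, VI Cor. 2.8 and VI Thm. 2.1 (proof, Steps 3, 5, 6)] -/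
theorem finite_etaleCohomology_of_isProper_of_zmod
    (h : ∀ (K : Type u) [Field K] [IsSepClosed K] (Y : Scheme.{u}) (f : Y ⟶ Spec (.of K))
      [IsProper f] (ℓ : ℕ) [Fact ℓ.Prime] (i : ℕ),
      Finite (((constantSheaf Y.smallEtaleTopology Ab.{u}).obj
        (AddCommGrpCat.of (ULift.{u} (ZMod ℓ)))).H i : Type u)) :
    finite_etaleCohomology_of_isProper.{u} := by
  intro K _ _ Y f _ M _ i
  exact finite_sheafH_constantSheaf_of_prime Y.smallEtaleTopology i (fun ℓ _ => h K Y f ℓ i) M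

/-- `finite_etaleCohomology_of_isProper` (all finite constant coefficients) is equivalent to its
case `M = ℤ/ℓ`, `ℓ` prime (the converse being the specialisation to the finite group `ℤ/ℓ`).
[cite: Milne2025, VI Thm. 2.1 (proof, Steps 3, 5, 6)] -/
theorem finite_etaleCohomology_of_isProper_iff_zmod :
    finite_etaleCohomology_of_isProper.{u} ↔
      ∀ (K : Type u) [Field K] [IsSepClosed K] (Y : Scheme.{u}) (f : Y ⟶ Spec (.of K))
        [IsProper f] (ℓ : ℕ) [Fact ℓ.Prime] (i : ℕ),
        Finite (((constantSheaf Y.smallEtaleTopology Ab.{u}).obj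
          (AddCommGrpCat.of (ULift.{u} (ZMod ℓ)))).H i : Type u) := by
  refine ⟨fun h K _ _ Y f _ ℓ _ i => ?_, finite_etaleCohomology_of_isProper_of_zmod⟩
  haveI : NeZero ℓ := ⟨(Fact.out : ℓ.Prime).ne_zero⟩
  haveI : Finite (AddCommGrpCat.of (ULift.{u} (ZMod ℓ))) :=
    inferInstanceAs (Finite (ULift.{u} (ZMod ℓ)))
  exact h K Y f _ i

end Literature.AlgebraicGeometry.Motives

end
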